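import Summits.Parity.GeneralizedHardyLittlewood.Theorems.LiouvilleMADTypeIIToLevel
import Literature.NumberTheory.Sieve.PolymathGEHPieces
import HarnessLib

/-!
# Crux `LambdaLiouvilleLevel` (stmt-Parity-13325, route `LiouvilleMAD`),
# line `log-power-dispersion`: stub `stub_vaughanAssembly`

Crux `Summit.Parity.GeneralizedHardyLittlewood.Theses.LiouvilleMAD.LambdaLiouvilleLevel`, line
`log-power-dispersion`, stub `stub_vaughanAssembly` (`TypeIIPieceLog h → LevelAt h`, stated unfolded
as `levelAt_of_typeIIPieceLog`): the log-power bound for the type-II piece `F_U * G_U` of Vaughan's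
identity, summed over the moduli `q ≤ N^{ε₃}` with coprime residues, implies Bombieri–Vinogradov
at level `N^{ε₀}`, `ε₀ = min(ε₃, 1/5)`, for `Λ(n) λ(n + h)` with arbitrary residues.

Proof (a re-threading of the tree theorem `TypeIIToLevel_proof`):
* moduli `q` with `(w q, q) > 1` are trivial: `n ≡ w q (q)` forces `(n, q) > 1`, so only prime
  powers of primes dividing `q` carry `Λ`, total `≤ ω(q) log N ≤ q log N` per modulus
  (`Sieve.sum_vonMangoldt_filter_not_coprime_le`), `≤ Q² log N` in all; elsewhere `w q` is
  replaced by the coprime residue `w' q` (`= w q` or `1`);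
* per modulus, Vaughan's identity `Λ = Λ_{≤U} + μ_{≤U} * log − c_U * ζ + F_U * G_U`,
  `U = ⌊N^{1/10}⌋`, against `1[n ≡ w' q (q)] λ(n + h)`: short piece `≤ U log U`, type-I pieces
  `≤ 4 log N ∑_{d ≤ U²} F q d` with the PROVED budget `F` of `TypeIIToLevel.typeI_budget`
  (Bombieri–Vinogradov for `λ`, heights `dt + h ≤ N + |h|`, `Q U² ≤ N^{2/5} ≤ (N + |h|)^{9/20}`),
  fourth piece kept exact;
* summed over `q ≤ Q = ⌊N^{ε₀}⌋ ≤ ⌊N^{ε₃}⌋`: fourth pieces = the hypothesis, type I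
  `≤ 8 C_I N/(log N)^A`, and `Q U log U + Q² log N ≤ 2N/(log N)^A` once `(log N)^{A+1} ≤ N^{1/2}`.
-/

noncomputable section

open Finset Real ArithmeticFunction
open Literature.NumberTheory.LFunctions.LiouvilleSum (abs_liouville_le_one)
open scoped ArithmeticFunction.zeta ArithmeticFunction.omega

namespace Summit.Parity.GeneralizedHardyLittlewood.Theorems.LambdaLiouvilleLevel.LogPowerDispersion

open Literature.NumberTheory.Sieve.Vaughan (cU fU gU arith_sub_apply vonMangoldt_eq_four_terms)
open Literature.NumberTheory.Sieve (moebiusTrunc vonMangoldtTrunc)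
open Summit.Parity.GeneralizedHardyLittlewood.Theorems.TypeIIToLevel (typeI_budget
  abs_sum_vonMangoldtTrunc_mul_le abs_sum_moebiusTrunc_log_mul_le abs_sum_cU_zeta_mul_le)

/-- **One modulus, three pieces.**  With `0 < U ≤ N`, a type-I budget `F q ·` valid up to the
height `X ≥ N + h`, a modulus `q ≥ 1`, any residue `w` and any height `y ≤ N`:
`|∑_{n ≤ y, n ≡ w (q)} Λ(n) λ(n+h)| ≤ U log U + 4 log N ∑_{d ≤ U²} F q d + |∑_{n ≤ y} (F_U*G_U)lam|`
where `lam(n) = 1[n ≡ w (q)] λ(n + h)` (Vaughan's identity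
`Λ = Λ_{≤U} + μ_{≤U} * log − c_U * ζ + F_U * G_U`; the short piece trivially, the two type-I
pieces by Abel summation against the budget).
[folklore] [cite: Vaughan1980, (12)–(16)] [cite: IwaniecKowalski2004, §13.4] -/
theorem abs_class_le_three_add_fourth {h : ℤ} {N X U : ℕ} (hU : 0 < U) (hUN : U ≤ N)
    (hX : (N : ℤ) + h ≤ X) (F : ℕ → ℕ → ℝ) (hF0 : ∀ q d, 0 ≤ F q d)
    (hF : ∀ q d w t : ℕ, 1 ≤ q → 1 ≤ d → ((d * t : ℕ) : ℤ) + h ≤ X →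
      |∑ m ∈ Ioc 0 t, (if d * m ≡ w [MOD q] then
        (liouville (Int.toNat (((d * m : ℕ) : ℤ) + h)) : ℝ) else 0)| ≤ F q d)
    {q : ℕ} (hq : 1 ≤ q) (w : ℕ) {y : ℕ} (hy : y ≤ N) :
    |∑ n ∈ (Icc 1 y).filter (fun n : ℕ => n ≡ w [MOD q]),
        ArithmeticFunction.vonMangoldt n * (liouville (Int.toNat ((n : ℤ) + h)) : ℝ)| ≤
      U * Real.log U + 4 * Real.log N * ∑ d ∈ Icc 1 (U * U), F q d +
        |∑ n ∈ Ioc 0 y, (fU U * gU U) n *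
          (if n ≡ w [MOD q] then (liouville (Int.toNat ((n : ℤ) + h)) : ℝ) else 0)| := by
  -- the class weight
  set lam : ℕ → ℝ := fun n =>
    if n ≡ w [MOD q] then (liouville (Int.toNat ((n : ℤ) + h)) : ℝ) else 0 with hlam
  have hlam1 : ∀ n, |lam n| ≤ 1 := by
    intro n; simp only [hlam]; split_ifs
    · exact abs_liouville_le_one _
    · simp
  have hconv : ∑ n ∈ (Icc 1 y).filter (fun n : ℕ => n ≡ w [MOD q]),
      ArithmeticFunction.vonMangoldt n * (liouville (Int.toNat ((n : ℤ) + h)) : ℝ) =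
      ∑ n ∈ Ioc 0 y, ArithmeticFunction.vonMangoldt n * lam n := by
    rw [sum_filter, show (Icc 1 y : Finset ℕ) = Ioc 0 y from rfl]
    refine sum_congr rfl fun n _ => ?_
    simp only [hlam]; split_ifs <;> simp
  have e4 : ∑ n ∈ Ioc 0 y, (fU U * gU U) n *
      (if n ≡ w [MOD q] then (liouville (Int.toNat ((n : ℤ) + h)) : ℝ) else 0) =
      ∑ n ∈ Ioc 0 y, (fU U * gU U) n * lam n :=
    sum_congr rfl fun n _ => by simp only [hlam]
  rw [hconv, e4]
  -- the type-I budget along `d ≤ U²` at the height `y ≤ N`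
  have hI : ∀ d t : ℕ, 1 ≤ d → d ≤ U * U → t ≤ y / d →
      |∑ m ∈ Ioc 0 t, lam (d * m)| ≤ F q d := by
    intro d t hd _ ht
    have hdt : d * t ≤ N := le_trans (Nat.mul_le_mul_left d ht) ((Nat.mul_div_le y d).trans hy)
    have hX' : ((d * t : ℕ) : ℤ) + h ≤ X := by
      have : ((d * t : ℕ) : ℤ) ≤ N := by exact_mod_cast hdt
      linarith
    exact hF q d w t hq hd hX'
  -- Vaughan's identity pointwise, distributed against `lam`
  have hΛ : ∀ n, (ArithmeticFunction.vonMangoldt n : ℝ) = vonMangoldtTrunc U n +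
      ((moebiusTrunc U : ArithmeticFunction ℝ) * ArithmeticFunction.log) n -
        (cU U * (ζ : ArithmeticFunction ℝ)) n + (fU U * gU U) n := by
    intro n
    have h := congrArg (fun G : ArithmeticFunction ℝ => G n) (vonMangoldt_eq_four_terms U)
    simp only [ArithmeticFunction.add_apply, arith_sub_apply] at h
    exact h
  have hsplit : ∑ n ∈ Ioc 0 y, ArithmeticFunction.vonMangoldt n * lam n =
      ∑ n ∈ Ioc 0 y, vonMangoldtTrunc U n * lam n +
        ∑ n ∈ Ioc 0 y,
          ((moebiusTrunc U : ArithmeticFunction ℝ) * ArithmeticFunction.log) n * lam n -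
        ∑ n ∈ Ioc 0 y, (cU U * (ζ : ArithmeticFunction ℝ)) n * lam n +
        ∑ n ∈ Ioc 0 y, (fU U * gU U) n * lam n := by
    simp_rw [hΛ, add_mul, sub_mul, add_mul, sum_add_distrib, sum_sub_distrib, sum_add_distrib]
  rw [hsplit]
  have h0 := abs_sum_vonMangoldtTrunc_mul_le hlam1 y U
  have h1 := abs_sum_moebiusTrunc_log_mul_le (F := F q) hI (hF0 q)
  have h2 := abs_sum_cU_zeta_mul_le (F := F q) hI (hF0 q)
  -- weaken `log y, log U ↦ log N` and `∑_{d ≤ U} ↦ ∑_{d ≤ U²}`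
  have hU0 : (0 : ℝ) < U := by exact_mod_cast hU
  have hlogU : Real.log U ≤ Real.log N := Real.log_le_log hU0 (by exact_mod_cast hUN)
  have hlogN : 0 ≤ Real.log N := Real.log_natCast_nonneg N
  have hlogy : Real.log y ≤ Real.log N := by
    rcases Nat.eq_zero_or_pos y with rfl | hy0
    · simp [hlogN]
    · exact Real.log_le_log (by exact_mod_cast hy0) (by exact_mod_cast hy)
  have hlogy0 : 0 ≤ Real.log y := Real.log_natCast_nonneg y
  have hlogU0 : 0 ≤ Real.log U := Real.log_natCast_nonneg U
  have hS0 : 0 ≤ ∑ d ∈ Ioc 0 (U * U), F q d := sum_nonneg fun d _ => hF0 q d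
  have hSU0 : 0 ≤ ∑ d ∈ Ioc 0 U, F q d := sum_nonneg fun d _ => hF0 q d
  have hSU : ∑ d ∈ Ioc 0 U, F q d ≤ ∑ d ∈ Ioc 0 (U * U), F q d :=
    sum_le_sum_of_subset_of_nonneg (Ioc_subset_Ioc_right (Nat.le_mul_self U))
      fun d _ _ => hF0 q d
  have hIcc : ∑ d ∈ Ioc 0 (U * U), F q d = ∑ d ∈ Icc 1 (U * U), F q d := rfl
  have h1' : 2 * Real.log y * ∑ d ∈ Ioc 0 U, F q d ≤
      2 * Real.log N * ∑ d ∈ Ioc 0 (U * U), F q d :=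
    mul_le_mul (by linarith) hSU hSU0 (by positivity)
  have h2' : 2 * Real.log U * ∑ d ∈ Ioc 0 (U * U), F q d ≤
      2 * Real.log N * ∑ d ∈ Ioc 0 (U * U), F q d :=
    mul_le_mul_of_nonneg_right (by linarith) hS0
  rw [← hIcc]
  have hA4 : ∀ a b c d : ℝ, |a + b - c + d| ≤ |a| + |b| + |c| + |d| := fun a b c d =>
    (abs_add_le _ _).trans
      (add_le_add ((abs_sub _ _).trans (add_le_add (abs_add_le _ _) le_rfl)) le_rfl)
  refine (hA4 _ _ _ _).trans ?_
  linarith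

/-- **Non-coprime classes are trivial.**  If `(w, q) > 1` then every `n ≡ w (q)` has
`(n, q) > 1`, so `Λ(n) ≠ 0` only at powers of the primes dividing `q`; hence, for `y ≤ N` and
`N ≥ 1`, `|∑_{n ≤ y, n ≡ w (q)} Λ(n) λ(n+h)| ≤ ∑_{n ≤ N, (n,q) > 1} Λ(n) ≤ ω(q) log N ≤ q log N`.
[folklore] [cite: Polymath8b2014, §4.2] -/
theorem abs_class_le_of_not_coprime (h : ℤ) {N q w y : ℕ} (hq : 1 ≤ q) (hN : 1 ≤ N)
    (hy : y ≤ N) (hw : ¬ Nat.Coprime w q) :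
    |∑ n ∈ (Icc 1 y).filter (fun n : ℕ => n ≡ w [MOD q]),
        ArithmeticFunction.vonMangoldt n * (liouville (Int.toNat ((n : ℤ) + h)) : ℝ)| ≤
      q * Real.log N := by
  calc |∑ n ∈ (Icc 1 y).filter (fun n : ℕ => n ≡ w [MOD q]),
        ArithmeticFunction.vonMangoldt n * (liouville (Int.toNat ((n : ℤ) + h)) : ℝ)|
      ≤ ∑ n ∈ (Icc 1 y).filter (fun n : ℕ => n ≡ w [MOD q]),
          ArithmeticFunction.vonMangoldt n := by
        refine (abs_sum_le_sum_abs _ _).trans (sum_le_sum fun n _ => ?_)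
        rw [abs_mul, abs_of_nonneg vonMangoldt_nonneg]
        exact (mul_le_mul_of_nonneg_left (abs_liouville_le_one _) vonMangoldt_nonneg).trans
          (mul_one _).le
    _ ≤ ∑ n ∈ (Icc 1 N).filter (fun n => ¬ n.Coprime q),
          ArithmeticFunction.vonMangoldt n := by
        refine sum_le_sum_of_subset_of_nonneg (fun n hn => ?_) fun _ _ _ => vonMangoldt_nonneg
        simp only [mem_filter, mem_Icc] at hn ⊢
        refine ⟨⟨hn.1.1, hn.1.2.trans hy⟩, fun hc => hw ?_⟩
        have h1 : Nat.gcd n q = 1 := hc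
        have h2 : Nat.gcd n q = Nat.gcd w q := hn.2.gcd_eq
        show Nat.gcd w q = 1
        rw [← h2]; exact h1
    _ ≤ (ω q : ℝ) * Real.log N :=
        Literature.NumberTheory.Sieve.sum_vonMangoldt_filter_not_coprime_le hq hN
    _ ≤ (q : ℝ) * Real.log N := by
        refine mul_le_mul_of_nonneg_right ?_ (Real.log_natCast_nonneg N)
        have hω : ω q ≤ q := by
          rw [ArithmeticFunction.cardDistinctFactors_apply, ← List.card_toFinset,
            Nat.toFinset_factors]
          calc q.primeFactors.card ≤ (Icc 1 q).card := card_le_card fun p hp =>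
                mem_Icc.2 ⟨(Nat.prime_of_mem_primeFactors hp).one_lt.le,
                  Nat.le_of_mem_primeFactors hp⟩
            _ = q := by simp
        exact_mod_cast hω

/-- **Stub `stub_vaughanAssembly` of the line `log-power-dispersion`** (crux stmt-Parity-13325,
`LiouvilleMAD.LambdaLiouvilleLevel`), stated with `TypeIIPieceLog h` and `LevelAt h` unfolded: the
log-power bound for the type-II piece `F_U * G_U` of Vaughan's identity (`U = ⌊N^{1/10}⌋`), summed
over the moduli `q ≤ N^{ε₃}` with coprime residues and heights `y q ≤ N`, implies
Bombieri–Vinogradov at level `N^{ε₀}`, `ε₀ = min(ε₃, 1/5)`, for `Λ(n) λ(n + h)`, one (arbitrary)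
residue and one height `≤ N` per modulus (non-coprime residues: `abs_class_le_of_not_coprime`;
per modulus: `abs_class_le_three_add_fourth` with the proved budget `TypeIIToLevel.typeI_budget` at
the height `N + |h|`, `Q U² ≤ N^{2/5}`; fourth pieces over `q ≤ ⌊N^{ε₀}⌋ ≤ ⌊N^{ε₃}⌋`: the
hypothesis; `Q U log U + Q² log N ≤ 2N/(log N)^A`).  Tree template: `TypeIIToLevel_proof`.
[cite: Vaughan1980, (12)–(16)] [cite: IwaniecKowalski2004, §13.4]
[cite: BombieriFriedlanderIwaniecActa1986, §1] -/
theorem levelAt_of_typeIIPieceLog (h : ℤ) :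
    (∃ ε₃ : ℝ, 0 < ε₃ ∧ ∀ A : ℝ, 0 < A → ∃ C : ℝ, ∃ N₀ : ℕ, ∀ N : ℕ, N₀ ≤ N →
      ∀ w y : ℕ → ℕ, (∀ q, y q ≤ N) → (∀ q, 1 ≤ q → Nat.Coprime (w q) q) →
        (∑ q ∈ Finset.Icc 1 ⌊(N : ℝ) ^ ε₃⌋₊,
          |∑ n ∈ Finset.Ioc 0 (y q),
            (fU ⌊(N : ℝ) ^ (1 / 10 : ℝ)⌋₊ * gU ⌊(N : ℝ) ^ (1 / 10 : ℝ)⌋₊) n *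
              (if n ≡ w q [MOD q] then
                (ArithmeticFunction.liouville (Int.toNat ((n : ℤ) + h)) : ℝ) else 0)|) ≤
          C * N / Real.log N ^ A) →
    (∃ ε₀ : ℝ, 0 < ε₀ ∧ ∀ A : ℝ, 0 < A → ∃ C : ℝ, ∃ N₀ : ℕ, ∀ N : ℕ, N₀ ≤ N → ∀ w y : ℕ → ℕ,
      (∀ q, y q ≤ N) →
        (∑ q ∈ Finset.Icc 1 ⌊(N : ℝ) ^ ε₀⌋₊,
          |∑ n ∈ (Finset.Icc 1 (y q)).filter (fun n : ℕ => n ≡ w q [MOD q]),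
            ArithmeticFunction.vonMangoldt n *
              (ArithmeticFunction.liouville (Int.toNat ((n : ℤ) + h)) : ℝ)|) ≤
          C * N / Real.log N ^ A) := by
  rintro ⟨ε₃, hε₃, hP⟩
  set ε₀ : ℝ := min ε₃ (1 / 5) with hε₀
  have hε₀0 : 0 < ε₀ := lt_min hε₃ (by norm_num)
  have hε₀3 : ε₀ ≤ ε₃ := min_le_left _ _
  have hε₀5 : ε₀ ≤ 1 / 5 := min_le_right _ _
  refine ⟨ε₀, hε₀0, fun A hA => ?_⟩
  -- constants
  obtain ⟨C₃, N₃, hC₃⟩ := hP A hA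
  obtain ⟨CI, X₀, hTI⟩ := typeI_budget h (A := A + 1) (by linarith)
  set CI' : ℝ := max CI 0 with hCI'
  have hCI'0 : 0 ≤ CI' := le_max_right _ _
  -- eventual inequalities
  have hev : ∀ᶠ x : ℝ in Filter.atTop,
      Real.log x ^ (A + 1) ≤ x ^ (1 / 2 : ℝ) ∧ (2 : ℝ) ^ (20 : ℕ) ≤ x :=
    (Literature.NumberTheory.Sieve.eventually_log_rpow_le_rpow (A + 1)
      (by norm_num : (0 : ℝ) < 1 / 2)).and (Filter.eventually_ge_atTop _)
  obtain ⟨x₁, hx₁⟩ := Filter.eventually_atTop.1 hev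
  refine ⟨C₃ + 8 * CI' + 2, max (max N₃ (max X₀ h.natAbs)) ⌈x₁⌉₊, fun N hN w y hyN => ?_⟩
  obtain ⟨⟨hNN₃, hNX₀, hNh⟩, hNx⟩ := by simpa only [max_le_iff] using hN
  have hNx₁ : x₁ ≤ (N : ℝ) := (Nat.le_ceil x₁).trans (by exact_mod_cast hNx)
  obtain ⟨hE1, hN20⟩ := hx₁ N hNx₁
  -- basic quantities
  have hN1 : (1 : ℝ) ≤ N := le_trans (by norm_num) hN20
  have hN1' : (1 : ℝ) < N := lt_of_lt_of_le (by norm_num) hN20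
  have hN0 : (0 : ℝ) < N := by linarith
  have hNnat : 1 ≤ N := by exact_mod_cast hN1
  have hL0 : 0 < Real.log N := Real.log_pos hN1'
  have hLA : 0 < Real.log N ^ A := Real.rpow_pos_of_pos hL0 _
  have ePow : ∀ a b : ℝ, (N : ℝ) ^ a * (N : ℝ) ^ b = (N : ℝ) ^ (a + b) := fun a b =>
    (Real.rpow_add hN0 a b).symm
  have mPow : ∀ a b : ℝ, a ≤ b → (N : ℝ) ^ a ≤ (N : ℝ) ^ b := fun a b hab =>
    Real.rpow_le_rpow_of_exponent_le hN1 hab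
  -- coprime residues
  set w' : ℕ → ℕ := fun q => if Nat.Coprime (w q) q then w q else 1 with hw'
  have hw'c : ∀ q, 1 ≤ q → Nat.Coprime (w' q) q := by
    intro q _
    by_cases hc : Nat.Coprime (w q) q
    · simpa only [hw', if_pos hc] using hc
    · simpa only [hw', if_neg hc] using Nat.coprime_one_left q
  -- the hypothesis at `N`, for the coprime residues `w'`
  have h4 := hC₃ N hNN₃ w' y hyN hw'c
  -- the parameters `U = ⌊N^{1/10}⌋`, `Q = ⌊N^{ε₀}⌋`
  have hu4 : (4 : ℝ) ≤ (N : ℝ) ^ (1 / 10 : ℝ) := by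
    have h220 : (4 : ℝ) = ((2 : ℝ) ^ (20 : ℕ)) ^ (1 / 10 : ℝ) := by
      rw [← Real.rpow_natCast, ← Real.rpow_mul (by norm_num)]; norm_num
    rw [h220]; exact Real.rpow_le_rpow (by positivity) hN20 (by norm_num)
  set U : ℕ := ⌊(N : ℝ) ^ (1 / 10 : ℝ)⌋₊ with hU
  have hUu : (U : ℝ) ≤ (N : ℝ) ^ (1 / 10 : ℝ) := Nat.floor_le (by positivity)
  have hU4 : 4 ≤ U := by rw [hU]; exact Nat.le_floor (by exact_mod_cast hu4)
  have hUpos : 0 < U := by omega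
  have hUr0 : (0 : ℝ) < U := by exact_mod_cast hUpos
  have hUN : U ≤ N := by
    have : (U : ℝ) ≤ N := hUu.trans (by simpa using mPow (1 / 10) 1 (by norm_num))
    exact_mod_cast this
  set Q : ℕ := ⌊(N : ℝ) ^ ε₀⌋₊ with hQ
  have hQP : (Q : ℝ) ≤ (N : ℝ) ^ ε₀ := Nat.floor_le (by positivity)
  have hQ5 : (Q : ℝ) ≤ (N : ℝ) ^ (1 / 5 : ℝ) := hQP.trans (mPow _ _ hε₀5)
  -- the type-I budget at the height `X = N + |h|`
  set X : ℕ := N + h.natAbs with hXdef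
  have hX : (N : ℤ) + h ≤ X := by
    rw [hXdef]; push_cast; linarith [le_abs_self h]
  have hX₀X : X₀ ≤ X := hNX₀.trans (Nat.le_add_right _ _)
  have hXN : (X : ℝ) ≤ 2 * N := by
    rw [hXdef]; push_cast
    have : ((h.natAbs : ℕ) : ℝ) ≤ N := by exact_mod_cast hNh
    linarith
  have hNX : (N : ℝ) ≤ X := by
    rw [hXdef]; push_cast; linarith [(Nat.cast_nonneg h.natAbs : (0 : ℝ) ≤ _)]
  have hQD : ((Q * (U * U) : ℕ) : ℝ) ≤ (X : ℝ) ^ (1 / 2 - 1 / 20 : ℝ) := by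
    have h1 : ((Q * (U * U) : ℕ) : ℝ) ≤
        (N : ℝ) ^ (1 / 5 : ℝ) * ((N : ℝ) ^ (1 / 10 : ℝ) * (N : ℝ) ^ (1 / 10 : ℝ)) := by
      push_cast
      exact mul_le_mul hQ5 (mul_le_mul hUu hUu hUr0.le (by positivity)) (by positivity)
        (by positivity)
    have h2 : (N : ℝ) ^ (1 / 5 : ℝ) * ((N : ℝ) ^ (1 / 10 : ℝ) * (N : ℝ) ^ (1 / 10 : ℝ)) =
        (N : ℝ) ^ (2 / 5 : ℝ) := by
      rw [ePow, ePow]; norm_num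
    have h3 : (N : ℝ) ^ (2 / 5 : ℝ) ≤ (N : ℝ) ^ (1 / 2 - 1 / 20 : ℝ) :=
      mPow _ _ (by norm_num)
    have h5 : (N : ℝ) ^ (1 / 2 - 1 / 20 : ℝ) ≤ (X : ℝ) ^ (1 / 2 - 1 / 20 : ℝ) :=
      Real.rpow_le_rpow hN0.le hNX (by norm_num)
    linarith
  obtain ⟨F, hF0, hF, hFsum⟩ := hTI X hX₀X Q (U * U) hQD
  -- one modulus: coprime reduction, then three pieces of Vaughan's identity
  have hperq : ∀ q ∈ Icc 1 Q,
      |∑ n ∈ (Icc 1 (y q)).filter (fun n : ℕ => n ≡ w q [MOD q]),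
          ArithmeticFunction.vonMangoldt n * (liouville (Int.toNat ((n : ℤ) + h)) : ℝ)| ≤
        U * Real.log U + 4 * Real.log N * ∑ d ∈ Icc 1 (U * U), F q d +
          |∑ n ∈ Ioc 0 (y q), (fU U * gU U) n *
            (if n ≡ w' q [MOD q] then (liouville (Int.toNat ((n : ℤ) + h)) : ℝ) else 0)| +
          Q * Real.log N := by
    intro q hq
    obtain ⟨hq1, hqQ⟩ := mem_Icc.1 hq
    have hmain :=
      abs_class_le_three_add_fourth (h := h) hUpos hUN hX F hF0 hF hq1 (w' q) (hyN q)
    have hQL : (q : ℝ) * Real.log N ≤ Q * Real.log N :=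
      mul_le_mul_of_nonneg_right (by exact_mod_cast hqQ) hL0.le
    have habs4 : 0 ≤ |∑ n ∈ Ioc 0 (y q), (fU U * gU U) n *
        (if n ≡ w' q [MOD q] then (liouville (Int.toNat ((n : ℤ) + h)) : ℝ) else 0)| :=
      abs_nonneg _
    have hS0 : 0 ≤ ∑ d ∈ Icc 1 (U * U), F q d := sum_nonneg fun d _ => hF0 q d
    have hUlogU : 0 ≤ (U : ℝ) * Real.log U := mul_nonneg hUr0.le (Real.log_natCast_nonneg U)
    have hq0 : (0 : ℝ) ≤ q * Real.log N := by positivity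
    by_cases hc : Nat.Coprime (w q) q
    · have hw'q : w' q = w q := by simp only [hw', if_pos hc]
      rw [← hw'q]
      linarith
    · have hnc := abs_class_le_of_not_coprime h hq1 hNnat (hyN q) hc
      have : 0 ≤ 4 * Real.log N * ∑ d ∈ Icc 1 (U * U), F q d := by positivity
      linarith
  -- sum over the moduli
  have hsum : ∑ q ∈ Icc 1 Q, |∑ n ∈ (Icc 1 (y q)).filter (fun n : ℕ => n ≡ w q [MOD q]),
      ArithmeticFunction.vonMangoldt n * (liouville (Int.toNat ((n : ℤ) + h)) : ℝ)| ≤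
      Q * (U * Real.log U) + 4 * Real.log N * ∑ q ∈ Icc 1 Q, ∑ d ∈ Icc 1 (U * U), F q d +
        ∑ q ∈ Icc 1 Q, |∑ n ∈ Ioc 0 (y q), (fU U * gU U) n *
            (if n ≡ w' q [MOD q] then (liouville (Int.toNat ((n : ℤ) + h)) : ℝ) else 0)| +
        Q * (Q * Real.log N) := by
    refine (sum_le_sum hperq).trans (le_of_eq ?_)
    simp only [sum_add_distrib, sum_const, Nat.card_Icc, Nat.add_sub_cancel, nsmul_eq_mul,
      mul_sum]
  refine hsum.trans ?_
  -- the type-II pieces: the hypothesis (`Q ≤ ⌊N^{ε₃}⌋`)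
  have h4le : ∑ q ∈ Icc 1 Q, |∑ n ∈ Ioc 0 (y q), (fU U * gU U) n *
      (if n ≡ w' q [MOD q] then (liouville (Int.toNat ((n : ℤ) + h)) : ℝ) else 0)| ≤
      C₃ * N / Real.log N ^ A := by
    refine le_trans ?_ h4
    exact sum_le_sum_of_subset_of_nonneg
      (Icc_subset_Icc_right (Nat.floor_le_floor (mPow _ _ hε₀3))) fun _ _ _ => abs_nonneg _
  -- the type-I part
  have hlogX : Real.log N ≤ Real.log X := Real.log_le_log hN0 hNX
  have hlogXpos : 0 < Real.log X ^ (A + 1) := Real.rpow_pos_of_pos (hL0.trans_le hlogX) _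
  have hTIle : 4 * Real.log N * ∑ q ∈ Icc 1 Q, ∑ d ∈ Icc 1 (U * U), F q d ≤
      8 * CI' * N / Real.log N ^ A := by
    have h1 : ∑ q ∈ Icc 1 Q, ∑ d ∈ Icc 1 (U * U), F q d ≤
        CI' * X / Real.log X ^ (A + 1) := by
      refine hFsum.trans ?_
      gcongr
      exact le_max_left _ _
    have h2 : CI' * X / Real.log X ^ (A + 1) ≤ CI' * (2 * N) / Real.log N ^ (A + 1) := by
      have hLA' : 0 < Real.log N ^ (A + 1) := Real.rpow_pos_of_pos hL0 _
      refine div_le_div₀ (by positivity) (mul_le_mul_of_nonneg_left hXN hCI'0) hLA' ?_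
      exact Real.rpow_le_rpow hL0.le hlogX (by linarith)
    have hLA1 : Real.log N ^ (A + 1) = Real.log N ^ A * Real.log N := by
      rw [Real.rpow_add hL0, Real.rpow_one]
    calc 4 * Real.log N * ∑ q ∈ Icc 1 Q, ∑ d ∈ Icc 1 (U * U), F q d
        ≤ 4 * Real.log N * (CI' * (2 * N) / Real.log N ^ (A + 1)) :=
          mul_le_mul_of_nonneg_left (h1.trans h2) (by positivity)
      _ = 8 * CI' * N / Real.log N ^ A := by
          rw [hLA1]
          have : Real.log N ^ A ≠ 0 := hLA.ne'
          field_simp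
          ring
  -- the trivial parts
  have hlogU0 : 0 ≤ Real.log U := Real.log_natCast_nonneg U
  have hlogU : Real.log U ≤ Real.log N := Real.log_le_log hUr0 (by exact_mod_cast hUN)
  have htriv1 : (Q : ℝ) * (U * Real.log U) ≤ N / Real.log N ^ A := by
    rw [le_div_iff₀ hLA]
    calc (Q : ℝ) * (U * Real.log U) * Real.log N ^ A
        ≤ (N : ℝ) ^ (1 / 5 : ℝ) * ((N : ℝ) ^ (1 / 10 : ℝ) * Real.log N) *
            Real.log N ^ A := by
          refine mul_le_mul_of_nonneg_right ?_ hLA.le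
          exact mul_le_mul hQ5 (mul_le_mul hUu hlogU hlogU0 (by positivity))
            (mul_nonneg hUr0.le hlogU0) (by positivity)
      _ = (N : ℝ) ^ (1 / 5 : ℝ) * (N : ℝ) ^ (1 / 10 : ℝ) * (Real.log N ^ A * Real.log N) := by ring
      _ = (N : ℝ) ^ (3 / 10 : ℝ) * Real.log N ^ (A + 1) := by
          rw [ePow, Real.rpow_add hL0, Real.rpow_one]; norm_num
      _ ≤ (N : ℝ) ^ (3 / 10 : ℝ) * (N : ℝ) ^ (1 / 2 : ℝ) :=
          mul_le_mul_of_nonneg_left hE1 (by positivity)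
      _ = (N : ℝ) ^ (4 / 5 : ℝ) := by rw [ePow]; norm_num
      _ ≤ N := by simpa using mPow (4 / 5) 1 (by norm_num)
  have htriv2 : (Q : ℝ) * (Q * Real.log N) ≤ N / Real.log N ^ A := by
    rw [le_div_iff₀ hLA]
    calc (Q : ℝ) * (Q * Real.log N) * Real.log N ^ A
        ≤ (N : ℝ) ^ (1 / 5 : ℝ) * ((N : ℝ) ^ (1 / 5 : ℝ) * Real.log N) *
            Real.log N ^ A := by
          refine mul_le_mul_of_nonneg_right ?_ hLA.le
          exact mul_le_mul hQ5 (mul_le_mul_of_nonneg_right hQ5 hL0.le)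
            (mul_nonneg (Nat.cast_nonneg Q) hL0.le) (by positivity)
      _ = (N : ℝ) ^ (1 / 5 : ℝ) * (N : ℝ) ^ (1 / 5 : ℝ) * (Real.log N ^ A * Real.log N) := by ring
      _ = (N : ℝ) ^ (2 / 5 : ℝ) * Real.log N ^ (A + 1) := by
          rw [ePow, Real.rpow_add hL0, Real.rpow_one]; norm_num
      _ ≤ (N : ℝ) ^ (2 / 5 : ℝ) * (N : ℝ) ^ (1 / 2 : ℝ) :=
          mul_le_mul_of_nonneg_left hE1 (by positivity)
      _ = (N : ℝ) ^ (9 / 10 : ℝ) := by rw [ePow]; norm_num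
      _ ≤ N := by simpa using mPow (9 / 10) 1 (by norm_num)
  -- total
  calc (Q : ℝ) * (U * Real.log U) +
        4 * Real.log N * ∑ q ∈ Icc 1 Q, ∑ d ∈ Icc 1 (U * U), F q d +
        ∑ q ∈ Icc 1 Q, |∑ n ∈ Ioc 0 (y q), (fU U * gU U) n *
            (if n ≡ w' q [MOD q] then (liouville (Int.toNat ((n : ℤ) + h)) : ℝ) else 0)| +
        Q * (Q * Real.log N)
      ≤ N / Real.log N ^ A + 8 * CI' * N / Real.log N ^ A + C₃ * N / Real.log N ^ A +
          N / Real.log N ^ A :=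
        add_le_add (add_le_add (add_le_add htriv1 hTIle) h4le) htriv2
    _ = (C₃ + 8 * CI' + 2) * N / Real.log N ^ A := by ring

end Summit.Parity.GeneralizedHardyLittlewood.Theorems.LambdaLiouvilleLevel.LogPowerDispersion

end
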